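import Literature.MathematicalPhysics.KineticTheory.HardSphereUniformGasShift
import Literature.Probability.Moments.PairSumVariance
import Literature.Probability.Moments.VarianceBookkeeping
import HarnessLib

/-!
# `L¹` concentration of weighted relative-speed pair sums of independent Maxwellian velocities

Topic `Literature/MathematicalPhysics/KineticTheory` (kind proof; no new notions).  For `n` independent velocities
`v_a ~ N(u, θ id)` on `ℝ³` (`gaussMeasure u θ`) and deterministic weights `w a b` vanishing on the diagonal, the
weighted pair sum of RELATIVE SPEEDS `Σ_a Σ_b w a b ‖v_a − v_b‖` — the velocity part of Enskog's collision
frequency `∫∫ |v − w| f f` read on an empirical measure (Chapman–Cowling 1970 §5.21, §16.4) — concentrates in `L¹`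
at `Θ̄ Σ_a Σ_b w a b`, `Θ̄ = E‖v − w‖` the mean relative speed of two independent Maxwellian velocities:

  `∫ |Σ_a Σ_b w a b (‖v_a − v_b‖ − Θ̄)| dN^{⊗n} ≤ √(8 n³ W² L²) + 2 S · E‖v − w‖² / L`

for every truncation level `L > 0`, where `|w a b| ≤ W` and `Σ_a Σ_b |w a b| ≤ S`
(`integral_abs_weightedRelSpeedSum_sub_le`).  The kernel `‖v − w‖` is unbounded, so the bounded-kernel
`U`-statistic variance bound (`Literature.Probability.Moments.variance_weightedPairSum_le`, Hoeffding 1948) is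
applied to the truncated kernel `min(‖v − w‖, L)` and the Gaussian tail `(‖v − w‖ − L)₊ ≤ ‖v − w‖²/L` is paid in
`L¹`.  With the empirical normalisation `W = O(n⁻²)`, `S = O(1)` the right side is `O(n^{-1/2} L + L⁻¹) → 0`.
Also: the second moment `E‖v − w‖² ≤ 4(‖u‖² + 3θ)` (`integral_norm_sub_sq_prod_gaussMeasure_le`), the mean identity
`∫ Σ w ‖v_a − v_b‖ = Θ̄ Σ w` (`integral_weightedRelSpeedSum`) and the `lintegral` form of the concentration bound.

## References

* S. Chapman, T. G. Cowling, *The Mathematical Theory of Non-Uniform Gases*, 3rd ed. (1970), §5.21, §16.4.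
  [ChapmanCowling1970]
* W. Hoeffding, Ann. Math. Statist. 19 (1948) 293–325, §5 (variance of a `U`-statistic). [folklore]
-/

noncomputable section

open MeasureTheory ProbabilityTheory Set Filter
open scoped ENNReal BigOperators

namespace Literature.MathematicalPhysics.KineticTheory

open Literature.Analysis.FluidPDE Literature.Probability.Moments

variable {n : ℕ} (u : V3) {θ : ℝ}

/-! ## Moments of one and two Maxwellian velocities -/

/-- The norm is integrable under `N(u, θ id)`. [folklore] -/
theorem integrable_norm_gaussMeasure (θ : ℝ) : Integrable (fun v : V3 => ‖v‖) (gaussMeasure u θ) :=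
  (IsGaussian.integrable_fun_id (μ := gaussMeasure u θ)).norm

/-- The squared norm is integrable under `N(u, θ id)`. [folklore] -/
theorem integrable_norm_sq_gaussMeasure (θ : ℝ) : Integrable (fun v : V3 => ‖v‖ ^ 2) (gaussMeasure u θ) :=
  (IsGaussian.memLp_id (gaussMeasure u θ) 2 (by simp)).integrable_norm_pow (by norm_num)

/-- **Second moment of a Maxwellian velocity**: `E‖v‖² = ‖u‖² + 3θ` under `N(u, θ id)` on `ℝ³` (`0 < θ`). [folklore] -/
theorem integral_norm_sq_gaussMeasure (hθ : 0 < θ) : ∫ v, ‖v‖ ^ 2 ∂gaussMeasure u θ = ‖u‖ ^ 2 + 3 * θ := by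
  have h0 := integral_energy_gaussMeasure (ι := Fin 3) u hθ
  have hint : Integrable (fun v : V3 => ‖v‖ ^ 2 / 2) (gaussMeasure u θ) :=
    (integrable_norm_sq_gaussMeasure u θ).div_const 2
  have hsplit : ∫ v, (‖v‖ ^ 2 / 2 - ‖u‖ ^ 2 / 2 - (Fintype.card (Fin 3) : ℝ) * θ / 2) ∂gaussMeasure u θ =
      (∫ v, ‖v‖ ^ 2 / 2 ∂gaussMeasure u θ) - (‖u‖ ^ 2 / 2 + (Fintype.card (Fin 3) : ℝ) * θ / 2) := by
    rw [show (fun v : V3 => ‖v‖ ^ 2 / 2 - ‖u‖ ^ 2 / 2 - (Fintype.card (Fin 3) : ℝ) * θ / 2) =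
      fun v => ‖v‖ ^ 2 / 2 - (‖u‖ ^ 2 / 2 + (Fintype.card (Fin 3) : ℝ) * θ / 2) by funext v; ring,
      integral_sub hint (integrable_const _), integral_const, smul_eq_mul, probReal_univ, one_mul]
  rw [hsplit, Fintype.card_fin] at h0
  have h2 : ∫ v, ‖v‖ ^ 2 / 2 ∂gaussMeasure u θ = (∫ v, ‖v‖ ^ 2 ∂gaussMeasure u θ) / 2 := by
    rw [← integral_div]
  rw [h2] at h0
  push_cast at h0
  linarith

/-- The relative speed of two velocities is continuous, hence measurable. [folklore] -/
theorem measurable_norm_fst_sub_snd : Measurable fun p : V3 × V3 => ‖p.1 - p.2‖ := by fun_prop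

/-- `‖x − y‖² ≤ 2‖x‖² + 2‖y‖²`. [folklore] -/
theorem norm_sub_sq_le_two_mul (x y : V3) : ‖x - y‖ ^ 2 ≤ 2 * ‖x‖ ^ 2 + 2 * ‖y‖ ^ 2 := by
  have h1 : ‖x - y‖ ^ 2 ≤ (‖x‖ + ‖y‖) ^ 2 := pow_le_pow_left₀ (norm_nonneg _) (norm_sub_le x y) 2
  nlinarith [sq_nonneg (‖x‖ - ‖y‖)]

/-- **The relative speed is integrable** under `N ⊗ N` (`‖v − w‖ ≤ ‖v‖ + ‖w‖`). [folklore] -/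
theorem integrable_norm_sub_prod_gaussMeasure (θ : ℝ) :
    Integrable (fun p : V3 × V3 => ‖p.1 - p.2‖) ((gaussMeasure u θ).prod (gaussMeasure u θ)) := by
  refine (((integrable_norm_gaussMeasure u θ).comp_fst (gaussMeasure u θ)).add
    ((integrable_norm_gaussMeasure u θ).comp_snd (gaussMeasure u θ))).mono'
    measurable_norm_fst_sub_snd.aestronglyMeasurable (Eventually.of_forall fun p => ?_)
  rw [Real.norm_eq_abs, abs_of_nonneg (norm_nonneg _)]
  exact norm_sub_le _ _

/-- **The squared relative speed is integrable** under `N ⊗ N` (`‖v − w‖² ≤ 2‖v‖² + 2‖w‖²`). [folklore] -/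
theorem integrable_norm_sub_sq_prod_gaussMeasure (θ : ℝ) :
    Integrable (fun p : V3 × V3 => ‖p.1 - p.2‖ ^ 2) ((gaussMeasure u θ).prod (gaussMeasure u θ)) := by
  have h1 : Integrable (fun p : V3 × V3 => ‖p.1‖ ^ 2) ((gaussMeasure u θ).prod (gaussMeasure u θ)) :=
    (integrable_norm_sq_gaussMeasure u θ).comp_fst _
  have h2 : Integrable (fun p : V3 × V3 => ‖p.2‖ ^ 2) ((gaussMeasure u θ).prod (gaussMeasure u θ)) :=
    (integrable_norm_sq_gaussMeasure u θ).comp_snd _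
  refine ((h1.const_mul 2).add (h2.const_mul 2)).mono' (measurable_norm_fst_sub_snd.pow_const 2).aestronglyMeasurable
    (Eventually.of_forall fun p => ?_)
  rw [Real.norm_eq_abs, abs_of_nonneg (sq_nonneg _)]
  exact norm_sub_sq_le_two_mul p.1 p.2

/-- **Second moment of the relative speed**: `E‖v − w‖² ≤ 4(‖u‖² + 3θ)` for independent `v, w ~ N(u, θ id)`
(`0 < θ`). [folklore] -/
theorem integral_norm_sub_sq_prod_gaussMeasure_le (hθ : 0 < θ) :
    ∫ p, ‖p.1 - p.2‖ ^ 2 ∂((gaussMeasure u θ).prod (gaussMeasure u θ)) ≤ 4 * (‖u‖ ^ 2 + 3 * θ) := by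
  have h1 : Integrable (fun p : V3 × V3 => ‖p.1‖ ^ 2) ((gaussMeasure u θ).prod (gaussMeasure u θ)) :=
    (integrable_norm_sq_gaussMeasure u θ).comp_fst _
  have h2 : Integrable (fun p : V3 × V3 => ‖p.2‖ ^ 2) ((gaussMeasure u θ).prod (gaussMeasure u θ)) :=
    (integrable_norm_sq_gaussMeasure u θ).comp_snd _
  have hE1 : ∫ p, ‖p.1‖ ^ 2 ∂((gaussMeasure u θ).prod (gaussMeasure u θ)) = ‖u‖ ^ 2 + 3 * θ := by
    rw [integral_fun_fst (fun v : V3 => ‖v‖ ^ 2), probReal_univ, one_smul, integral_norm_sq_gaussMeasure u hθ]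
  have hE2 : ∫ p, ‖p.2‖ ^ 2 ∂((gaussMeasure u θ).prod (gaussMeasure u θ)) = ‖u‖ ^ 2 + 3 * θ := by
    rw [integral_fun_snd (fun v : V3 => ‖v‖ ^ 2), probReal_univ, one_smul, integral_norm_sq_gaussMeasure u hθ]
  calc ∫ p, ‖p.1 - p.2‖ ^ 2 ∂((gaussMeasure u θ).prod (gaussMeasure u θ))
      ≤ ∫ p, (2 * ‖p.1‖ ^ 2 + 2 * ‖p.2‖ ^ 2) ∂((gaussMeasure u θ).prod (gaussMeasure u θ)) :=
        integral_mono (integrable_norm_sub_sq_prod_gaussMeasure u θ) ((h1.const_mul 2).add (h2.const_mul 2))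
          fun p => norm_sub_sq_le_two_mul p.1 p.2
    _ = 4 * (‖u‖ ^ 2 + 3 * θ) := by
        rw [integral_add (h1.const_mul 2) (h2.const_mul 2), integral_const_mul, integral_const_mul, hE1, hE2]; ring

/-- The mean relative speed is nonnegative. [folklore] -/
theorem integral_norm_sub_prod_gaussMeasure_nonneg (θ : ℝ) :
    0 ≤ ∫ p, ‖p.1 - p.2‖ ∂((gaussMeasure u θ).prod (gaussMeasure u θ)) :=
  integral_nonneg fun _ => norm_nonneg _

/-- **Truncation tail of the relative speed**: `E[‖v − w‖ − min(‖v − w‖, L)] ≤ E‖v − w‖² / L` (`0 < L`; pointwise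
`(s − L)₊ ≤ s²/L`). [folklore] -/
theorem integral_norm_sub_sub_min_le {L : ℝ} (hL : 0 < L) (θ : ℝ) :
    ∫ p, (‖p.1 - p.2‖ - min ‖p.1 - p.2‖ L) ∂((gaussMeasure u θ).prod (gaussMeasure u θ)) ≤
      (∫ p, ‖p.1 - p.2‖ ^ 2 ∂((gaussMeasure u θ).prod (gaussMeasure u θ))) / L := by
  rw [← integral_div]
  refine integral_mono_of_nonneg (Eventually.of_forall fun p => sub_nonneg.2 (min_le_left _ _))
    ((integrable_norm_sub_sq_prod_gaussMeasure u θ).div_const L) (Eventually.of_forall fun p => ?_)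
  set s := ‖p.1 - p.2‖ with hs
  have hs0 : 0 ≤ s := norm_nonneg _
  change s - min s L ≤ s ^ 2 / L
  rw [le_div_iff₀ hL]
  rcases le_total s L with h | h
  · rw [min_eq_left h, sub_self, zero_mul]; positivity
  · rw [min_eq_right h]; nlinarith

/-- The truncation tail is nonnegative. [folklore] -/
theorem integral_norm_sub_sub_min_nonneg (L θ : ℝ) :
    0 ≤ ∫ p, (‖p.1 - p.2‖ - min ‖p.1 - p.2‖ L) ∂((gaussMeasure u θ).prod (gaussMeasure u θ)) :=
  integral_nonneg fun _ => sub_nonneg.2 (min_le_left _ _)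

/-! ## Pair sums of relative speeds of `n` independent velocities -/

/-- The norm of one velocity is integrable under `N^{⊗n}`. [folklore] -/
theorem integrable_norm_eval_pi_gaussMeasure (θ : ℝ) (a : Fin n) :
    Integrable (fun v : Fin n → V3 => ‖v a‖) (Measure.pi fun _ : Fin n => gaussMeasure u θ) :=
  ((measurePreserving_eval (fun _ : Fin n => gaussMeasure u θ) a).integrable_comp
    (integrable_norm_gaussMeasure u θ).aestronglyMeasurable).2 (integrable_norm_gaussMeasure u θ)

/-- **The relative speed of two of `n` independent velocities is integrable** under `N^{⊗n}`. [folklore] -/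
theorem integrable_norm_eval_sub_eval (θ : ℝ) (a b : Fin n) :
    Integrable (fun v : Fin n → V3 => ‖v a - v b‖) (Measure.pi fun _ : Fin n => gaussMeasure u θ) := by
  refine ((integrable_norm_eval_pi_gaussMeasure u θ a).add (integrable_norm_eval_pi_gaussMeasure u θ b)).mono'
    (by fun_prop : Measurable fun v : Fin n → V3 => ‖v a - v b‖).aestronglyMeasurable (Eventually.of_forall fun v => ?_)
  rw [Real.norm_eq_abs, abs_of_nonneg (norm_nonneg _)]
  exact norm_sub_le _ _

/-- The truncated relative speed of two of `n` velocities is integrable under `N^{⊗n}`. [folklore] -/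
theorem integrable_min_norm_eval_sub_eval (θ : ℝ) {L : ℝ} (hL : 0 ≤ L) (a b : Fin n) :
    Integrable (fun v : Fin n → V3 => min ‖v a - v b‖ L) (Measure.pi fun _ : Fin n => gaussMeasure u θ) := by
  refine (integrable_norm_eval_sub_eval u θ a b).mono'
    ((by fun_prop : Measurable fun v : Fin n → V3 => ‖v a - v b‖).min measurable_const).aestronglyMeasurable
    (Eventually.of_forall fun v => ?_)
  rw [Real.norm_eq_abs, abs_of_nonneg (le_min (norm_nonneg _) hL)]
  exact min_le_left _ _

/-- The truncated relative speed is integrable under `N ⊗ N` (`0 ≤ L`). [folklore] -/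
theorem integrable_min_norm_sub_prod_gaussMeasure (θ : ℝ) {L : ℝ} (hL : 0 ≤ L) :
    Integrable (fun p : V3 × V3 => min ‖p.1 - p.2‖ L) ((gaussMeasure u θ).prod (gaussMeasure u θ)) := by
  refine (integrable_norm_sub_prod_gaussMeasure u θ).mono' (measurable_norm_fst_sub_snd.min measurable_const).aestronglyMeasurable
    (Eventually.of_forall fun p => ?_)
  rw [Real.norm_eq_abs, abs_of_nonneg (le_min (norm_nonneg _) hL)]
  exact min_le_left _ _

/-- **Mean of a pair term**: `∫ f(v_a, v_b) dN^{⊗n} = ∫ f d(N ⊗ N)` for `a ≠ b` and measurable `f`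
(`integral_pi_pair`). [folklore] -/
theorem integral_pair_eq (θ : ℝ) {a b : Fin n} (hab : a ≠ b) {f : V3 × V3 → ℝ} (hf : Measurable f) :
    ∫ v, f (v a, v b) ∂(Measure.pi fun _ : Fin n => gaussMeasure u θ) =
      ∫ p, f p ∂((gaussMeasure u θ).prod (gaussMeasure u θ)) :=
  integral_pi_pair (gaussMeasure u θ) hab hf.aestronglyMeasurable

/-- **Mean of a weighted pair sum**: `∫ Σ_a Σ_b w a b (f(v_a, v_b) − c) dN^{⊗n} = (∫ f d(N ⊗ N) − c) Σ_a Σ_b w a b`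
for a measurable kernel `f` with integrable pair terms and weights vanishing on the diagonal. [folklore] -/
theorem integral_weightedPairSum_eq (θ : ℝ) {f : V3 × V3 → ℝ} (hf : Measurable f)
    (hfi : ∀ a b : Fin n, Integrable (fun v : Fin n → V3 => f (v a, v b)) (Measure.pi fun _ : Fin n => gaussMeasure u θ))
    {w : Fin n → Fin n → ℝ} (hdiag : ∀ a, w a a = 0) (c : ℝ) :
    ∫ v, ∑ a, ∑ b, w a b * (f (v a, v b) - c) ∂(Measure.pi fun _ : Fin n => gaussMeasure u θ) =
      ((∫ p, f p ∂((gaussMeasure u θ).prod (gaussMeasure u θ))) - c) * ∑ a, ∑ b, w a b := by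
  have hint : ∀ a b : Fin n, Integrable (fun v : Fin n → V3 => w a b * (f (v a, v b) - c))
      (Measure.pi fun _ : Fin n => gaussMeasure u θ) := fun a b => ((hfi a b).sub (integrable_const c)).const_mul _
  rw [integral_finsetSum _ fun a _ => integrable_finsetSum _ fun b _ => hint a b, Finset.mul_sum]
  refine Finset.sum_congr rfl fun a _ => ?_
  rw [integral_finsetSum _ fun b _ => hint a b, Finset.mul_sum]
  refine Finset.sum_congr rfl fun b _ => ?_
  rw [integral_const_mul]
  by_cases hab : a = b
  · subst hab; rw [hdiag a]; ring
  · rw [integral_sub (hfi a b) (integrable_const c), integral_const, smul_eq_mul, probReal_univ, one_mul,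
      integral_pair_eq u θ hab hf]
    ring

/-- **Mean of a weighted relative-speed pair sum**: `∫ Σ_a Σ_b w a b (‖v_a − v_b‖ − c) = (Θ̄ − c) Σ_a Σ_b w a b`
for weights vanishing on the diagonal, `Θ̄ = E‖v − w‖`. [folklore] -/
theorem integral_weightedRelSpeedSum (θ : ℝ) {w : Fin n → Fin n → ℝ} (hdiag : ∀ a, w a a = 0) (c : ℝ) :
    ∫ v, ∑ a, ∑ b, w a b * (‖v a - v b‖ - c) ∂(Measure.pi fun _ : Fin n => gaussMeasure u θ) =
      ((∫ p, ‖p.1 - p.2‖ ∂((gaussMeasure u θ).prod (gaussMeasure u θ))) - c) * ∑ a, ∑ b, w a b :=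
  integral_weightedPairSum_eq u θ measurable_norm_fst_sub_snd (integrable_norm_eval_sub_eval u θ) hdiag c

/-- A weighted pair sum of relative speeds is integrable under `N^{⊗n}`. [folklore] -/
theorem integrable_weightedRelSpeedSum (θ : ℝ) (w : Fin n → Fin n → ℝ) (c : ℝ) :
    Integrable (fun v : Fin n → V3 => ∑ a, ∑ b, w a b * (‖v a - v b‖ - c))
      (Measure.pi fun _ : Fin n => gaussMeasure u θ) :=
  integrable_finsetSum _ fun a _ => integrable_finsetSum _ fun b _ =>
    ((integrable_norm_eval_sub_eval u θ a b).sub (integrable_const c)).const_mul _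

/-- A double sum of absolute values of products is bounded by `S · K` when each second factor is `≤ K` in absolute
value and the absolute weights sum to `≤ S`. [folklore] -/
theorem abs_sum_sum_mul_le {w : Fin n → Fin n → ℝ} {S K : ℝ} (hS : ∑ a, ∑ b, |w a b| ≤ S) (hK : 0 ≤ K)
    (g : Fin n → Fin n → ℝ) (hg : ∀ a b, |g a b| ≤ K) : |∑ a, ∑ b, w a b * g a b| ≤ S * K := by
  calc |∑ a, ∑ b, w a b * g a b| ≤ ∑ a, |∑ b, w a b * g a b| := Finset.abs_sum_le_sum_abs _ _
    _ ≤ ∑ a, ∑ b, |w a b| * K := Finset.sum_le_sum fun a _ => (Finset.abs_sum_le_sum_abs _ _).trans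
        (Finset.sum_le_sum fun b _ => by rw [abs_mul]; exact mul_le_mul_of_nonneg_left (hg a b) (abs_nonneg _))
    _ = (∑ a, ∑ b, |w a b|) * K := by rw [Finset.sum_mul]; exact Finset.sum_congr rfl fun a _ => by rw [Finset.sum_mul]
    _ ≤ S * K := mul_le_mul_of_nonneg_right hS hK

/-- **`L¹` concentration of a weighted relative-speed pair sum** (the main estimate).  For weights `w` vanishing on
the diagonal with `|w a b| ≤ W`, `Σ_a Σ_b |w a b| ≤ S`, and every truncation level `L > 0`:
`∫ |Σ_a Σ_b w a b (‖v_a − v_b‖ − Θ̄)| dN^{⊗n} ≤ √(32 n³ W² L²) + 2 S · E‖v − w‖² / L`, `Θ̄ = E‖v − w‖`.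
Proof: truncate the kernel at `L` and centre it (`|min(·, L) − E min| ≤ 2L`): the bounded-kernel `U`-statistic
variance bound and Jensen control this part in `L¹`; the tail `(‖·‖ − L)₊ ≤ ‖·‖²/L` is paid twice in `L¹`.
[cite: ChapmanCowling1970, §16.4] -/
theorem integral_abs_weightedRelSpeedSum_sub_le (θ : ℝ) {w : Fin n → Fin n → ℝ} {W S : ℝ}
    (hW : ∀ a b, |w a b| ≤ W) (hS : ∑ a, ∑ b, |w a b| ≤ S) (hdiag : ∀ a, w a a = 0) {L : ℝ} (hL : 0 < L) :
    ∫ v, |∑ a, ∑ b, w a b * (‖v a - v b‖ - ∫ p, ‖p.1 - p.2‖ ∂((gaussMeasure u θ).prod (gaussMeasure u θ)))|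
        ∂(Measure.pi fun _ : Fin n => gaussMeasure u θ) ≤
      Real.sqrt (32 * (n : ℝ) ^ 3 * W ^ 2 * L ^ 2) +
        2 * S * ((∫ p, ‖p.1 - p.2‖ ^ 2 ∂((gaussMeasure u θ).prod (gaussMeasure u θ))) / L) := by
  set γ := gaussMeasure u θ with hγ
  set Γ : Measure (Fin n → V3) := Measure.pi fun _ : Fin n => γ with hΓ
  set Θb : ℝ := ∫ p, ‖p.1 - p.2‖ ∂(γ.prod γ) with hΘb
  set ΘL : ℝ := ∫ p, min ‖p.1 - p.2‖ L ∂(γ.prod γ) with hΘL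
  set C₂ : ℝ := ∫ p, ‖p.1 - p.2‖ ^ 2 ∂(γ.prod γ) with hC₂
  have hS0 : 0 ≤ S := le_trans (Finset.sum_nonneg fun a _ => Finset.sum_nonneg fun b _ => abs_nonneg _) hS
  have hdiag' : ∀ a, |w a a| = 0 := fun a => by rw [hdiag a, abs_zero]
  -- the truncated, centred kernel
  set Θ : V3 × V3 → ℝ := fun p => min ‖p.1 - p.2‖ L - ΘL with hΘdef
  have hminm : Measurable fun p : V3 × V3 => min ‖p.1 - p.2‖ L := measurable_norm_fst_sub_snd.min measurable_const
  have hΘm : Measurable Θ := hminm.sub measurable_const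
  have hmin_bd : ∀ p : V3 × V3, |min ‖p.1 - p.2‖ L| ≤ L := fun p => by
    rw [abs_of_nonneg (le_min (norm_nonneg _) hL.le)]; exact min_le_right _ _
  have hΘL_abs : |ΘL| ≤ L := by
    have h := norm_integral_le_of_norm_le_const (μ := γ.prod γ) (f := fun p : V3 × V3 => min ‖p.1 - p.2‖ L) (C := L)
      (Eventually.of_forall fun p => by rw [Real.norm_eq_abs]; exact hmin_bd p)
    rwa [probReal_univ, mul_one, Real.norm_eq_abs] at h
  have hΘbd : ∀ p, |Θ p| ≤ 2 * L := fun p => by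
    rw [hΘdef]
    calc |min ‖p.1 - p.2‖ L - ΘL| ≤ |min ‖p.1 - p.2‖ L| + |ΘL| := abs_sub _ _
      _ ≤ L + L := add_le_add (hmin_bd p) hΘL_abs
      _ = 2 * L := by ring
  -- the truncated centred pair sum `Y`, the tail sum `T`
  set Y : (Fin n → V3) → ℝ := fun v => ∑ a, ∑ b, w a b * Θ (v a, v b) with hYdef
  set T : (Fin n → V3) → ℝ := fun v => ∑ a, ∑ b, |w a b| * (‖v a - v b‖ - min ‖v a - v b‖ L) with hTdef
  have hYm : Measurable Y := by
    refine Finset.measurable_sum _ fun a _ => Finset.measurable_sum _ fun b _ => ?_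
    exact (hΘm.comp ((measurable_pi_apply a).prodMk (measurable_pi_apply b))).const_mul _
  have hYbd : ∀ v, |Y v| ≤ S * (2 * L) := fun v => abs_sum_sum_mul_le hS (by positivity) _ fun a b => hΘbd _
  -- the truncation gap `Θb − ΘL = E[(‖·‖ − L)₊] ∈ [0, C₂/L]`
  have hgap : Θb - ΘL = ∫ p, (‖p.1 - p.2‖ - min ‖p.1 - p.2‖ L) ∂(γ.prod γ) := by
    rw [integral_sub (integrable_norm_sub_prod_gaussMeasure u θ) (integrable_min_norm_sub_prod_gaussMeasure u θ hL.le)]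
  have hgap0 : 0 ≤ Θb - ΘL := by rw [hgap]; exact integral_norm_sub_sub_min_nonneg u L θ
  have hgapC : Θb - ΘL ≤ C₂ / L := by rw [hgap]; exact integral_norm_sub_sub_min_le u hL θ
  -- pointwise decomposition: `X = Y + Σ w (‖·‖ − min) − (Θb − ΘL) Σ w`
  have hpt : ∀ v : Fin n → V3, |∑ a, ∑ b, w a b * (‖v a - v b‖ - Θb)| ≤ |Y v| + T v + (Θb - ΘL) * S := by
    intro v
    have hdec : ∑ a, ∑ b, w a b * (‖v a - v b‖ - Θb) =
        Y v + ∑ a, ∑ b, w a b * (‖v a - v b‖ - min ‖v a - v b‖ L) - (Θb - ΘL) * ∑ a, ∑ b, w a b := by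
      rw [hYdef, hΘdef]
      simp only [Finset.mul_sum, ← Finset.sum_add_distrib, ← Finset.sum_sub_distrib]
      refine Finset.sum_congr rfl fun a _ => Finset.sum_congr rfl fun b _ => ?_
      ring
    rw [hdec]
    have h2 : |∑ a, ∑ b, w a b * (‖v a - v b‖ - min ‖v a - v b‖ L)| ≤ T v := by
      rw [hTdef]
      refine (Finset.abs_sum_le_sum_abs _ _).trans (Finset.sum_le_sum fun a _ =>
        (Finset.abs_sum_le_sum_abs _ _).trans (Finset.sum_le_sum fun b _ => ?_))
      rw [abs_mul, abs_of_nonneg (sub_nonneg.2 (min_le_left _ _))]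
    have h3 : |(Θb - ΘL) * ∑ a, ∑ b, w a b| ≤ (Θb - ΘL) * S := by
      rw [abs_mul, abs_of_nonneg hgap0]
      refine mul_le_mul_of_nonneg_left ?_ hgap0
      exact (Finset.abs_sum_le_sum_abs _ _).trans
        ((Finset.sum_le_sum fun a _ => Finset.abs_sum_le_sum_abs _ _).trans hS)
    calc |Y v + ∑ a, ∑ b, w a b * (‖v a - v b‖ - min ‖v a - v b‖ L) - (Θb - ΘL) * ∑ a, ∑ b, w a b|
        ≤ |Y v + ∑ a, ∑ b, w a b * (‖v a - v b‖ - min ‖v a - v b‖ L)| + |(Θb - ΘL) * ∑ a, ∑ b, w a b| :=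
          abs_sub _ _
      _ ≤ (|Y v| + |∑ a, ∑ b, w a b * (‖v a - v b‖ - min ‖v a - v b‖ L)|) + |(Θb - ΘL) * ∑ a, ∑ b, w a b| :=
          add_le_add_left (abs_add_le _ _) _
      _ ≤ |Y v| + T v + (Θb - ΘL) * S := by linarith
  -- `E Y = 0`, `Var Y ≤ 32 n³ W² L²`, hence `∫ |Y| ≤ √(32 n³ W² L²)` (Jensen)
  have hEY : ∫ v, Y v ∂Γ = 0 := by
    have h := integral_weightedPairSum_eq u θ hminm (integrable_min_norm_eval_sub_eval u θ hL.le) hdiag ΘL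
    rw [hΘL, sub_self, zero_mul] at h
    exact h
  have hVar : variance Y Γ ≤ 8 * (n : ℝ) ^ 3 * W ^ 2 * (2 * L) ^ 2 := by
    have h := variance_weightedPairSum_le (ι := Fin n) γ hΘm hΘbd hW
    rwa [Fintype.card_fin] at h
  have hY2 : ∫ v, |Y v| ^ 2 ∂Γ ≤ 32 * (n : ℝ) ^ 3 * W ^ 2 * L ^ 2 := by
    have h1 : ∫ v, |Y v| ^ 2 ∂Γ = variance Y Γ := by
      simp_rw [sq_abs]
      rw [variance_eq_integral hYm.aemeasurable, hEY]
      simp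
    rw [h1]
    calc variance Y Γ ≤ 8 * (n : ℝ) ^ 3 * W ^ 2 * (2 * L) ^ 2 := hVar
      _ = 32 * (n : ℝ) ^ 3 * W ^ 2 * L ^ 2 := by ring
  have hYL1 : ∫ v, |Y v| ∂Γ ≤ Real.sqrt (32 * (n : ℝ) ^ 3 * W ^ 2 * L ^ 2) := by
    have hJ := sq_integral_le_integral_sq_of_abs_le (ν := Γ) (h := fun v => |Y v|) hYm.abs (K := S * (2 * L))
      (fun v => by rw [abs_abs]; exact hYbd v)
    rw [Real.le_sqrt (integral_nonneg fun v => abs_nonneg _) (by positivity)]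
    exact hJ.trans hY2
  -- `∫ T = (Θb − ΘL) Σ|w| ≤ (Θb − ΘL) S`
  have hTI : ∀ a b : Fin n, Integrable (fun v : Fin n → V3 => ‖v a - v b‖ - min ‖v a - v b‖ L) Γ := fun a b =>
    (integrable_norm_eval_sub_eval u θ a b).sub (integrable_min_norm_eval_sub_eval u θ hL.le a b)
  have hTeq : ∫ v, T v ∂Γ = (Θb - ΘL) * ∑ a, ∑ b, |w a b| := by
    have h := integral_weightedPairSum_eq u θ (f := fun p : V3 × V3 => ‖p.1 - p.2‖ - min ‖p.1 - p.2‖ L)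
      (measurable_norm_fst_sub_snd.sub hminm) hTI (w := fun a b => |w a b|) hdiag' 0
    simp only [sub_zero] at h
    rw [hTdef, h, ← hgap]
  have hTle : ∫ v, T v ∂Γ ≤ (Θb - ΘL) * S := by
    rw [hTeq]; exact mul_le_mul_of_nonneg_left hS hgap0
  -- integrate the pointwise bound
  have hXint : Integrable (fun v : Fin n → V3 => |∑ a, ∑ b, w a b * (‖v a - v b‖ - Θb)|) Γ :=
    (integrable_weightedRelSpeedSum u θ w Θb).abs
  have hYint : Integrable (fun v => |Y v|) Γ :=
    Integrable.of_bound hYm.abs.aestronglyMeasurable (S * (2 * L))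
      (Eventually.of_forall fun v => by rw [Real.norm_eq_abs, abs_abs]; exact hYbd v)
  have hTint : Integrable T Γ :=
    integrable_finsetSum _ fun a _ => integrable_finsetSum _ fun b _ => (hTI a b).const_mul (|w a b|)
  calc ∫ v, |∑ a, ∑ b, w a b * (‖v a - v b‖ - Θb)| ∂Γ
      ≤ ∫ v, (|Y v| + T v + (Θb - ΘL) * S) ∂Γ :=
        integral_mono hXint ((hYint.add hTint).add (integrable_const _)) hpt
    _ = (∫ v, |Y v| ∂Γ) + (∫ v, T v ∂Γ) + (Θb - ΘL) * S := by
        have h1 : Integrable (fun v => |Y v| + T v) Γ := hYint.add hTint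
        rw [integral_add h1 (integrable_const _), integral_add hYint hTint, integral_const, smul_eq_mul,
          probReal_univ, one_mul]
    _ ≤ Real.sqrt (32 * (n : ℝ) ^ 3 * W ^ 2 * L ^ 2) + (Θb - ΘL) * S + (Θb - ΘL) * S := by gcongr
    _ ≤ Real.sqrt (32 * (n : ℝ) ^ 3 * W ^ 2 * L ^ 2) + 2 * S * (C₂ / L) := by nlinarith [hgapC, hS0]

/-- **`lintegral` form of the `L¹` concentration bound** (no integrability bookkeeping for the user):
`∫⁻ ‖Σ_a Σ_b w a b (‖v_a − v_b‖ − Θ̄)‖ₑ dN^{⊗n} ≤ ofReal(√(32 n³ W² L²) + 2 S · E‖v − w‖² / L)`. [folklore] -/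
theorem lintegral_enorm_weightedRelSpeedSum_sub_le (θ : ℝ) {w : Fin n → Fin n → ℝ} {W S : ℝ}
    (hW : ∀ a b, |w a b| ≤ W) (hS : ∑ a, ∑ b, |w a b| ≤ S) (hdiag : ∀ a, w a a = 0) {L : ℝ} (hL : 0 < L) :
    ∫⁻ v, ‖∑ a, ∑ b, w a b * (‖v a - v b‖ - ∫ p, ‖p.1 - p.2‖ ∂((gaussMeasure u θ).prod (gaussMeasure u θ)))‖ₑ
        ∂(Measure.pi fun _ : Fin n => gaussMeasure u θ) ≤
      ENNReal.ofReal (Real.sqrt (32 * (n : ℝ) ^ 3 * W ^ 2 * L ^ 2) +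
        2 * S * ((∫ p, ‖p.1 - p.2‖ ^ 2 ∂((gaussMeasure u θ).prod (gaussMeasure u θ))) / L)) := by
  have hXint := (integrable_weightedRelSpeedSum u θ w
    (∫ p, ‖p.1 - p.2‖ ∂((gaussMeasure u θ).prod (gaussMeasure u θ)))).abs
  simp only [Real.enorm_eq_ofReal_abs]
  rw [← ofReal_integral_eq_lintegral_ofReal hXint (Eventually.of_forall fun v => abs_nonneg _)]
  exact ENNReal.ofReal_le_ofReal (integral_abs_weightedRelSpeedSum_sub_le u θ hW hS hdiag hL)

end Literature.MathematicalPhysics.KineticTheory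

end
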